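import Summits.BirchSwinnertonDyer.BirchSwinnertonDyer.Theorems.EisensteinPrimesMazurMCOnX1RankZeroMudescent
import HarnessLib

/-!
# Crux `MazurMCOnX1RankZero` (route `EisensteinPrimes`, rung K5, item stmt-BirchSwinnertonDyer-19035):
# the crux idea `trifkovic-gram-series-reciprocity` FACTORS THROUGH the door of line `mudescent` —
# its two typed shadows (K2 "the Gram series controls the invariants", K1 "mod-`p` reciprocity,
# numerical form") at the étale ends imply stubs 3 ∧ 4 verbatim, hence the crux by name

HONEST FRAMING (cell `bsd-eis`, seat `bsd-eis-k5-c5` gen 4; ladder row A3 = X1 ∩ {r_an = 0}, type A).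
THEOREMS ONLY; nothing is closed or booked; no definition, no fact restated; every input is a NAMED
hypothesis. The crux is OPEN in the refereed record and CLAIMED only by Keller–Yin v2 Thm. 3.0.10
(preprint). This file answers, in the kernel, the question a triage of the ideation seat's card
(`bsd-eis-idea` g0, 2026-08-27, `HOME/idea-g0/idea-trifkovic-gram-series-reciprocity.md`, LENS MEMO
§4; card's `Sketch.lean` = `HOME/idea-g0/Sketch-gram-series.lean`, its `firstLemma_holds`) must ask:
WHERE does the Gram-series lever sit relative to the registered lines? Answer: its typed open content
— at every rank-`0` X1 pair `(W₀, p)` OFF the μ-barrier locus (`¬ HasRamifiedOddLineAt W₀ p`, the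
étale end) there are `a sLoc c0 : ℕ` with

  (K2) `∀` cyclotomic `κ`, top generator `γ`, torsion dual datum `D`: `μ(D.X) = 0 ∧ λ(D.X) + c0 = a + sLoc`
       (Trifković's flat duality pairing made `Λ`-adic: `a = ord_T r_{E₀}`, `sLoc`, `c0` local counts —
       OUTSIDE the kernel; here parameters), and
  (K1) `X1.MuPart.AnalyticMuLE W₀ p 0 ∧ X1.ParitySqueeze.AnalyticLambdaEq W₀ p (a + sLoc - c0)`
       (the mod-`p` explicit reciprocity `r_{E₀} ≐ L̄_p(E₀)` in numerical form: `μ_an = 0`, `λ_an = a + sLoc − c0`)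

— IMPLIES the two open stubs of the `mudescent` door (`stub_analyticMuZero_offLocus`,
`stub_lambdaCount_offLocus`, signatures VERBATIM as in
`EisensteinPrimesMazurMCOnX1RankZeroMudescent.mazurMCOnX1RankZero_of_analyticMuZero_offLocus_of_lambdaCount_offLocus`,
ky g8 p522804), with `n = k = a + sLoc − c0`; so the card is a MECHANISM for stubs 3 ∧ 4 (it proposes
where the numbers come from), not a new residue, and it inherits their placement: off the
`EisensteinMuConjecture` barrier locus, containing Greenberg's Conj. 1.11 on the leaf (§3: K2 alone
forces `μ = 0` at the étale end — strictly MORE than the crux asks, which is why no converse is stated).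

* §1 `stubs_of_gramData` — K1 ∧ K2 at the étale ends ⟹ stub 3 ∧ stub 4 (pure logic + `omega`).
* §2 `mazurMCOnX1RankZero_of_gramData` — the crux (fully-qualified route decl) from
  `EisensteinPrimes.PublishedInputs` + Kato–Wuthrich (`Wuthrich2014.charIdeal_dvd_padicLFunction`) +
  the Gram data at the étale ends: §1 composed with the `mudescent` door BY NAME;
  `mazurMainConjecture_of_gramDataAt` — per member (the card's `FirstLemma` with its two shadows
  unfolded; no rank or locus hypothesis is needed at the member itself: route T).
* §3 `mu_eq_zero_of_gramControls` — what K2 asserts beyond the crux (`μ(D.X) = 0`, no fact used).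

References: `Theorems/EisensteinPrimesMazurMCOnX1RankZeroMudescent.lean` (door, §1 per-member route T),
`Rank1Residual/X1/TamagawaSqueeze.lean` (route T), `Rank1Residual/X1/MuPart.lean`, `…/ParitySqueeze.lean`.
[cite: Trifkovic2005, Prop. 1, Thms 2–4] [cite: GreenbergLNM1716, Conj. 1.11 (p. 58), Prop. 5.7, Cor. 5.6 (p. 136)]
[cite: Wuthrich2014, Thm. 16 (p. 397)] [cite: PollackWake2025, Thm. 1.2]
-/

set_option linter.dupNamespace false
set_option autoImplicit false

noncomputable section

open WeierstrassCurve Literature.NumberTheory.EllipticCurves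
  Literature.NumberTheory.EllipticCurves.Rank1Residual
  Literature.NumberTheory.EllipticCurves.ModularForms
open Literature.Barriers.BirchSwinnertonDyer (HasRamifiedOddLineAt)
open Summit.BirchSwinnertonDyer.Rank1Residual
open Summit.BirchSwinnertonDyer.BirchSwinnertonDyer.Theses
open Summit.BirchSwinnertonDyer.BirchSwinnertonDyer.Theorems
open Summit.BirchSwinnertonDyer.BirchSwinnertonDyer.Theorems.Rank1ResidualX1Defs
open Summit.BirchSwinnertonDyer.BirchSwinnertonDyer.Theorems.EisensteinPrimesMazurMCOnX1RankZeroMudescent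

namespace Summit.BirchSwinnertonDyer.BirchSwinnertonDyer.Theorems.EisensteinPrimesMazurMCOnX1RankZeroGramSeriesDoor

/-! ## §1. Gram data at the étale ends ⟹ `mudescent` stubs 3 ∧ 4 verbatim -/

/-- **K1 ∧ K2 at the étale ends imply `stub_analyticMuZero_offLocus` ∧ `stub_lambdaCount_offLocus`**
(signatures verbatim as the `mudescent` door's hypotheses `hμ`, `hlc`). Stub 3 is K1's first conjunct;
for stub 4 take `n = k = a + sLoc − c0`: K1's second conjunct is `AnalyticLambdaEq W₀ p n`, and K2's
`λ(D.X) + c0 = a + sLoc` gives `X1.TamagawaSqueeze.AlgebraicLambdaGE W₀ p k` (`k ≤ λ(D.X)` by `omega`).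
Pure logic; no fact. [folklore] -/
theorem stubs_of_gramData
    (hgram : ∀ (W₀ : WeierstrassCurve ℚ) [W₀.IsElliptic] [W₀.IsGloballyMinimal] (p : ℕ) [Fact p.Prime],
      ClassX1 W₀ p → W₀.analyticRank = 0 → ¬ HasRamifiedOddLineAt W₀ p →
        ∃ a sLoc c0 : ℕ, c0 ≤ a + sLoc ∧
          (∀ (κ : ZpExtension ℚ p) (γ : Field.absoluteGaloisGroup ℚ), κ.IsCyclotomic →
            κ.IsTopGenerator γ → ∀ (D : W₀.SelmerDualData κ γ) [Module.Finite (IwasawaAlgebra p) D.X],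
              D.IsTorsion → muInvariant p D.X = 0 ∧ lambdaInvariant p D.X + c0 = a + sLoc) ∧
          (X1.MuPart.AnalyticMuLE W₀ p 0 ∧ X1.ParitySqueeze.AnalyticLambdaEq W₀ p (a + sLoc - c0))) :
    (∀ (W₀ : WeierstrassCurve ℚ) [W₀.IsElliptic] [W₀.IsGloballyMinimal] (p : ℕ) [Fact p.Prime],
      ClassX1 W₀ p → W₀.analyticRank = 0 → ¬ HasRamifiedOddLineAt W₀ p →
        X1.MuPart.AnalyticMuLE W₀ p 0) ∧
    (∀ (W₀ : WeierstrassCurve ℚ) [W₀.IsElliptic] [W₀.IsGloballyMinimal] (p : ℕ) [Fact p.Prime],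
      ClassX1 W₀ p → W₀.analyticRank = 0 → ¬ HasRamifiedOddLineAt W₀ p →
        ∃ n k : ℕ, X1.ParitySqueeze.AnalyticLambdaEq W₀ p n ∧
          X1.TamagawaSqueeze.AlgebraicLambdaGE W₀ p k ∧ n ≤ k) := by
  refine ⟨fun W₀ _ _ p _ hX1 hr0 hoff ↦ ?_, fun W₀ _ _ p _ hX1 hr0 hoff ↦ ?_⟩
  · obtain ⟨a, sLoc, c0, -, -, hK1⟩ := hgram W₀ p hX1 hr0 hoff
    exact hK1.1
  · obtain ⟨a, sLoc, c0, -, hK2, hK1⟩ := hgram W₀ p hX1 hr0 hoff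
    refine ⟨a + sLoc - c0, a + sLoc - c0, hK1.2, ?_, le_rfl⟩
    intro κ γ hκ hγ D _ hT
    have h2 := (hK2 κ γ hκ hγ D hT).2
    omega

/-! ## §2. The crux by name from the Gram data (through the `mudescent` door), and the per-member form -/

/-- **The crux `MazurMCOnX1RankZero` (route decl by name) from the route's `PublishedInputs`,
Kato–Wuthrich divisibility, and the Gram data (K1 ∧ K2) at every rank-`0` type-A étale end** —
§1 composed with the `mudescent` door
`mazurMCOnX1RankZero_of_analyticMuZero_offLocus_of_lambdaCount_offLocus` (descend to the étale end by
`stub_locate`, route T there, ascend by isogeny invariance). CONDITIONAL; the item stays open: the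
Gram data are the card's cruxes K1 (mod-`p` reciprocity) and K2 (`Λ`-adic Trifković pairing), neither in
print. [cite: Trifkovic2005, Prop. 1, Thms 2–4] [cite: GreenbergLNM1716, Cor. 5.6 (p. 136), Conj. 1.11]
[cite: Wuthrich2014, Thm. 16 (p. 397)] -/
theorem mazurMCOnX1RankZero_of_gramData (hP : EisensteinPrimes.PublishedInputs)
    (hW16 : Wuthrich2014.charIdeal_dvd_padicLFunction)
    (hgram : ∀ (W₀ : WeierstrassCurve ℚ) [W₀.IsElliptic] [W₀.IsGloballyMinimal] (p : ℕ) [Fact p.Prime],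
      ClassX1 W₀ p → W₀.analyticRank = 0 → ¬ HasRamifiedOddLineAt W₀ p →
        ∃ a sLoc c0 : ℕ, c0 ≤ a + sLoc ∧
          (∀ (κ : ZpExtension ℚ p) (γ : Field.absoluteGaloisGroup ℚ), κ.IsCyclotomic →
            κ.IsTopGenerator γ → ∀ (D : W₀.SelmerDualData κ γ) [Module.Finite (IwasawaAlgebra p) D.X],
              D.IsTorsion → muInvariant p D.X = 0 ∧ lambdaInvariant p D.X + c0 = a + sLoc) ∧
          (X1.MuPart.AnalyticMuLE W₀ p 0 ∧ X1.ParitySqueeze.AnalyticLambdaEq W₀ p (a + sLoc - c0))) :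
    Summit.BirchSwinnertonDyer.BirchSwinnertonDyer.Theses.EisensteinPrimes.MazurMCOnX1RankZero :=
  have h := stubs_of_gramData hgram
  mazurMCOnX1RankZero_of_analyticMuZero_offLocus_of_lambdaCount_offLocus hP hW16 h.1 h.2

/-- **Per member (the card's `FirstLemma`, shadows unfolded): Gram data at a member `W` of class X1
⟹ Mazur's main conjecture at `(W, p)`** — route T at `W` itself
(`X1.MuPart.muPartAt_of_analyticMuLE_zero`, `X1.TamagawaSqueeze.mazurMainConjecture_of_algebraicLambdaGE`;
a good Eisenstein `p > 2` is ordinary by `goodOrd_of_red_of_good`). Only `2 < p`, `Red`, `Good` of the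
class are used; no rank and no locus hypothesis (the étale end is where the data are EXPECTED, not
where the implication needs them). [cite: GreenbergLNM1716, Cor. 5.6 (p. 136)] [cite: Wuthrich2014, Thm. 16 (p. 397)] -/
theorem mazurMainConjecture_of_gramDataAt (hW16 : Wuthrich2014.charIdeal_dvd_padicLFunction)
    (W : WeierstrassCurve ℚ) [W.IsElliptic] [W.IsGloballyMinimal] (p : ℕ) [Fact p.Prime]
    (hX1 : ClassX1 W p) {a sLoc c0 : ℕ}
    (hK2 : ∀ (κ : ZpExtension ℚ p) (γ : Field.absoluteGaloisGroup ℚ), κ.IsCyclotomic →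
      κ.IsTopGenerator γ → ∀ (D : W.SelmerDualData κ γ) [Module.Finite (IwasawaAlgebra p) D.X],
        D.IsTorsion → muInvariant p D.X = 0 ∧ lambdaInvariant p D.X + c0 = a + sLoc)
    (hK1 : X1.MuPart.AnalyticMuLE W p 0 ∧ X1.ParitySqueeze.AnalyticLambdaEq W p (a + sLoc - c0)) :
    MazurMainConjecture W p := by
  have hp2 : 2 < p := hX1.1
  have hred : Red W p := hX1.2.1
  have hgood : Good W p := hX1.2.2.1
  have hp : p ≠ 2 := by omega
  obtain ⟨-, hord⟩ := goodOrd_of_red_of_good W p hp2 hgood hred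
  have hμ : X1.MuLambda.MuPartAt W p :=
    X1.MuPart.muPartAt_of_analyticMuLE_zero hW16 hp hgood hord hred hK1.1
  have halg : X1.TamagawaSqueeze.AlgebraicLambdaGE W p (a + sLoc - c0) := by
    intro κ γ hκ hγ D _ hT
    have h2 := (hK2 κ γ hκ hγ D hT).2
    omega
  exact X1.TamagawaSqueeze.mazurMainConjecture_of_algebraicLambdaGE hW16 hp hgood hord hred hμ hK1.2
    halg le_rfl

/-- **Gram data at ONE isogenous member ⟹ Mazur's main conjecture at the rank-`0` X1 pair** (the
member is typically the étale end `W₀`; ascent by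
`Rank1ResidualX1Isogeny.mazurMainConjecture_iff_of_isIsogenous_of_analyticRank_eq_zero` — Wuthrich
Thm. 16, Greenberg Thm. 4.1, modularity, GZK, Cassels). [cite: GreenbergLNM1716, Thm. 4.1, Cor. 5.6 (p. 136)]
[cite: Wuthrich2014, Thm. 16 (p. 397), Lemma 17] [cite: MilneADT2006, Thm. I.7.3] -/
theorem mazurMainConjecture_of_gramDataAt_of_isIsogenous
    (hW16 : Wuthrich2014.charIdeal_dvd_padicLFunction) (hGr : greenberg_charValue_rankZero)
    (hmod : nonempty_modularParametrizationData) (hnf : exists_isNewformOf)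
    (hGZK : rank_eq_analyticRank_of_analyticRank_le_one) (hCassels : bsdRHS_eq_of_isIsogenous)
    (W : WeierstrassCurve ℚ) [W.IsElliptic] [W.IsGloballyMinimal] (p : ℕ) [Fact p.Prime]
    (hX1 : ClassX1 W p) (hr0 : W.analyticRank = 0)
    (W₀ : WeierstrassCurve ℚ) [W₀.IsElliptic] [W₀.IsGloballyMinimal] (hiso : IsIsogenous W W₀)
    {a sLoc c0 : ℕ}
    (hK2 : ∀ (κ : ZpExtension ℚ p) (γ : Field.absoluteGaloisGroup ℚ), κ.IsCyclotomic →
      κ.IsTopGenerator γ → ∀ (D : W₀.SelmerDualData κ γ) [Module.Finite (IwasawaAlgebra p) D.X],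
        D.IsTorsion → muInvariant p D.X = 0 ∧ lambdaInvariant p D.X + c0 = a + sLoc)
    (hK1 : X1.MuPart.AnalyticMuLE W₀ p 0 ∧ X1.ParitySqueeze.AnalyticLambdaEq W₀ p (a + sLoc - c0)) :
    MazurMainConjecture W p := by
  have hmod' : hasEntireLFunction_rat :=
    WeierstrassCurve.hasEntireLFunction_rat_of_exists_isNewformOf hnf
  have hX1₀ : ClassX1 W₀ p := ClassX1.of_isIsogenous hiso hX1
  exact (Rank1ResidualX1Isogeny.mazurMainConjecture_iff_of_isIsogenous_of_analyticRank_eq_zero hW16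
    hGr hmod hmod' hGZK hCassels W W₀ hiso p hX1 hr0).mpr
      (mazurMainConjecture_of_gramDataAt hW16 W₀ p hX1₀ hK2 hK1)

/-! ## §3. What K2 asserts beyond the crux -/

/-- **K2 alone forces `μ = 0` at the member** (for every cyclotomic `κ`, top generator `γ` and torsion
dual datum `D`: `μ(D.X) = 0`) — Greenberg's Conj. 1.11 in located form at the étale end, which the
crux does NOT assert (Mazur's main conjecture fixes `μ_alg = μ_an`, not their value). So the Gram data
are STRICTLY stronger than what the crux needs at that member, exactly as `mudescent` stub 3; no
converse "crux ⟹ Gram data" is claimed. No fact used. [cite: GreenbergLNM1716, Conj. 1.11 (p. 58)] -/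
theorem mu_eq_zero_of_gramControls (W : WeierstrassCurve ℚ) [W.IsElliptic] [W.IsGloballyMinimal]
    (p : ℕ) [Fact p.Prime] {a sLoc c0 : ℕ}
    (hK2 : ∀ (κ : ZpExtension ℚ p) (γ : Field.absoluteGaloisGroup ℚ), κ.IsCyclotomic →
      κ.IsTopGenerator γ → ∀ (D : W.SelmerDualData κ γ) [Module.Finite (IwasawaAlgebra p) D.X],
        D.IsTorsion → muInvariant p D.X = 0 ∧ lambdaInvariant p D.X + c0 = a + sLoc)
    {κ : ZpExtension ℚ p} {γ : Field.absoluteGaloisGroup ℚ} (hκ : κ.IsCyclotomic)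
    (hγ : κ.IsTopGenerator γ) (D : W.SelmerDualData κ γ) [Module.Finite (IwasawaAlgebra p) D.X]
    (hT : D.IsTorsion) : muInvariant p D.X = 0 :=
  (hK2 κ γ hκ hγ D hT).1

/-- **… and pins `λ` at the member**: `λ(D.X) = a + sLoc − c0` for every torsion dual datum (given
`c0 ≤ a + sLoc`), the EXACT count the card predicts (R5 of its refuter list: on the ten `λ_an = 2` prime
Kummer classes a certified `λ_alg` must read `2`). No fact used. [cite: Trifkovic2005, Thms 2–3] -/
theorem lambda_eq_of_gramControls (W : WeierstrassCurve ℚ) [W.IsElliptic] [W.IsGloballyMinimal]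
    (p : ℕ) [Fact p.Prime] {a sLoc c0 : ℕ} (hle : c0 ≤ a + sLoc)
    (hK2 : ∀ (κ : ZpExtension ℚ p) (γ : Field.absoluteGaloisGroup ℚ), κ.IsCyclotomic →
      κ.IsTopGenerator γ → ∀ (D : W.SelmerDualData κ γ) [Module.Finite (IwasawaAlgebra p) D.X],
        D.IsTorsion → muInvariant p D.X = 0 ∧ lambdaInvariant p D.X + c0 = a + sLoc)
    {κ : ZpExtension ℚ p} {γ : Field.absoluteGaloisGroup ℚ} (hκ : κ.IsCyclotomic)
    (hγ : κ.IsTopGenerator γ) (D : W.SelmerDualData κ γ) [Module.Finite (IwasawaAlgebra p) D.X]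
    (hT : D.IsTorsion) : lambdaInvariant p D.X = a + sLoc - c0 := by
  have h2 := (hK2 κ γ hκ hγ D hT).2
  omega

end Summit.BirchSwinnertonDyer.BirchSwinnertonDyer.Theorems.EisensteinPrimesMazurMCOnX1RankZeroGramSeriesDoor

end
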